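import Summits.MatrixMultiplication.MatrixMultiplication.Theorems.FarEdgeDescentSummableWorlds
import HarnessLib

/-!
# Route `FarEdgeDescent` — the CONTACT SCALE of the special leaf and the model worlds of the two-sided dial:
`FiniteSaturation ⟹ SuperFactorialContact ⟹ SuperExpContact`, the residual law of the new leaf, and three
worlds proving every new inclusion strict and every leaf of the traded cut load-bearing — all PROVED

decomp-mm ROOT cell (D-0178), lens 2 «structural dichotomy: special vs generic», gen 20; companion of
`FarEdgeDescentTradeoff` (the factorial floor under the aside `ExpDoublingDefect` = EDD, stmt-27702, and the exact cut
`ω = 2 ⟺ SuperFactorialContact ∧ ExpDoublingDefect`; `SuperFactorialContact` = SFC is stmt-27703; route rev 12).  Notation: `e(x) := ω(1,x,1) − (x+1)`, `w := ω − 2`,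
`u := x − 1`.  §1 is about the TRUE exponents (by name over the route asides); §§2–4 are about explicit MODEL
profiles `E : ℝ → ℝ` (closed forms `hE`; nothing is claimed there about the true exponents).

* §1 **THE CONTACT SCALE (PROVED).**  `SuperFactorialContact → SuperExpContact (28901)` (`sec_of_sfc`:
  `exp(−c·k·log k) ≤ ρ^k` once `c ≥ |log ρ|/log 2`), and the residual of the new leaf is a factorial-floor law
  with free constants: `(SFC → ω = 2) ⟺ (ω > 2 → ∃ c > 0 ∀ k ≥ 2, e(k) ≥ exp(−c·k·log k))`
  (`sfcResidual_iff_factorialFloorLaw`; compare `FarEdgeDescentDefectDial.residual_iff_expFloorLaw`).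
* §2 **GAMMA WORLD: both new inclusions strict, and the trade is FORCED (PROVED).**
  `E(x) = w·exp(−(3/2)u − u·log x)` has a FACTORIAL FLOOR `E(k) ≥ exp(−c·k·log k)` (`gammaWorld_factorialFloor`)
  — with gen 19's `gammaWorld_linearDefect` (EDD-shape, `C = 1`, `A = 2 log 2`), `gammaWorld_contact` (SEC-shape)
  and `gammaWorld_not_sld`: ONE world with `w > 0` carrying EDD and SEC but neither SLD nor SFC
  (`gammaWorld_twoSided`).  So `EDD ⊋ SLD`, `SEC ⊋ SFC` as profile classes, the engine's rate `k·log k` is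
  attained, and the MIXED pair (SEC, EDD) is NOT a cut: weakening the law from SLD to EDD forces strengthening
  the contact leaf from SEC to SFC.
* §3 **GAUSSIAN WORLD: EDD is load-bearing in the traded cut, and the dial goes on (PROVED).**
  `E(x) = w·exp(−u²)` (`0 < w ≤ 1`) has the supporting line (`gaussWorld₂_line`), superfactorial contact
  (`gaussWorld₂_sfc`), the NEXT law `E(m)² = exp(2(m−1)²)·w·E(2m−1)` with equality (`gaussWorld₂_gdd`) but NOT
  EDD (`gaussWorld₂_not_edd`), and a Gaussian floor (`gaussWorld₂_floor`): the pair (SFC, Gaussian defect) is not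
  a cut — in `closes_eddSfc` the exponential envelope cannot be relaxed — while the floor says which contact leaf
  the next notch needs (contact below every Gaussian rate).
* §4 **EXPONENTIAL WORLD: no FIXED-rate contact partners any law (PROVED).**  For every `0 < w` and every rate
  `θ > 0` the world `E(x) = w·exp(−λu)`, `λ = |log w| + 2|log θ| + 1`, satisfies the real three-term law and the
  anchored law with EQUALITY, the supporting line, is zero-free, and yet has contact at rate `θ`: `E(2) < θ²`
  (`expWorld_fixedRate`).  So a special leaf `∃ k ≥ 2, e(k) < θ^k` at one fixed `θ` is consistent with every law
  of the dial in a world with `ω > 2`: the contact leaf must quantify over ALL rates — `SuperExpContact` is the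
  bottom of the contact scale that can partner a law, as `FiniteSaturation` (a zero) is its top.

Imports only the BUILT module `FarEdgeDescentSummableWorlds`; no definitions; restates nothing.
[cite: LottiRomani1983, §1 (p. 173), §2 (p. 174)] [cite: Coppersmith1982] [cite: HuangPan1998, §8]
-/

set_option linter.dupNamespace false

noncomputable section

namespace Summit.MatrixMultiplication.MatrixMultiplication.Theorems.FarEdgeDescentContactScale

open Literature.Computability.AlgebraicComplexity
open Summit.MatrixMultiplication.MatrixMultiplication.Theses.FarEdgeDescent
open Summit.MatrixMultiplication.MatrixMultiplication.Theorems.FarEdgeDescentExpFloor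
open Summit.MatrixMultiplication.MatrixMultiplication.Theorems.FarEdgeDescentDefectWorlds
open Summit.MatrixMultiplication.MatrixMultiplication.Theorems.FarEdgeDescentSummableWorlds

/-! ## §1 The contact scale of the special leaf, by name -/

/-- **`SuperFactorialContact → SuperExpContact (28901)` (PROVED):** contact below every factorial rate is
contact below every exponential rate (`exp(−c·k·log k) ≤ ρ^k` as soon as `c ≥ |log ρ|/log 2`, `k ≥ 2`). -/
theorem sec_of_sfc (h : SuperFactorialContact) : SuperExpContact := by
  intro ρ hρ
  have hl2 : 0 < Real.log 2 := Real.log_pos one_lt_two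
  obtain ⟨k, hk, hek⟩ := h (|Real.log ρ| / Real.log 2 + 1) (by positivity)
  refine ⟨k, hk, hek.trans_le ?_⟩
  have hk2 : (2 : ℝ) ≤ k := by exact_mod_cast hk
  have hkpos : (0 : ℝ) < k := by linarith
  have hℓ : Real.log 2 ≤ Real.log k := Real.log_le_log two_pos hk2
  have hρk : ρ ^ k = Real.exp ((k : ℝ) * Real.log ρ) := by rw [Real.exp_nat_mul, Real.exp_log hρ]
  rw [hρk, Real.exp_le_exp]
  have h1 : |Real.log ρ| * k ≤ (|Real.log ρ| / Real.log 2 + 1) * k * Real.log k := by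
    have e : (|Real.log ρ| / Real.log 2 + 1) * k * Real.log k =
        |Real.log ρ| * k * (Real.log k / Real.log 2) + k * Real.log k := by
      field_simp
    rw [e]
    have h2 : |Real.log ρ| * k ≤ |Real.log ρ| * k * (Real.log k / Real.log 2) :=
      le_mul_of_one_le_right (by positivity) (by rw [le_div_iff₀ hl2, one_mul]; exact hℓ)
    nlinarith [mul_nonneg hkpos.le (hl2.le.trans hℓ)]
  have h3 : -((k : ℝ) * Real.log ρ) ≤ |Real.log ρ| * k := by
    have := neg_abs_le (Real.log ρ)
    nlinarith
  linarith

/-- **The residual of the new special leaf is a factorial-floor law with free constants (PROVED):**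
`(SuperFactorialContact → ω = 2) ⟺ (ω > 2 → ∃ c > 0, ∀ k ≥ 2, e(k) ≥ exp(−c·k·log k))`. -/
theorem sfcResidual_iff_factorialFloorLaw :
    (SuperFactorialContact → _root_.MatrixMultiplication) ↔
      (2 < omega ℂ → ∃ c : ℝ, 0 < c ∧ ∀ k : ℕ, 2 ≤ k →
        Real.exp (-(c * k * Real.log k)) ≤ omegaRect ℂ 1 k 1 - (k + 1)) := by
  constructor
  · intro h hω
    by_contra hne
    push Not at hne
    have hS : SuperFactorialContact := fun c hc => hne c hc
    have hmm := h hS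
    rw [_root_.MatrixMultiplication_iff] at hmm
    linarith
  · intro h hS
    rw [_root_.MatrixMultiplication_iff]
    refine le_antisymm (not_lt.1 fun hω => ?_) (omega_two_le (K := ℂ))
    obtain ⟨c, hc, hfloor⟩ := h hω
    obtain ⟨k, hk, hek⟩ := hS c hc
    have := hfloor k hk
    linarith

/-! ## §2 The gamma world: factorial floor — `EDD ⊋ SLD`, `SEC ⊋ SFC`, and the mixed pair is no cut -/

/-- **Factorial floor of the gamma world (PROVED).**  `E(x) = w·exp(−(3/2)(x−1) − (x−1)·log x)` satisfies
`E(k) ≥ exp(−c·k·log k)` for all integers `k ≥ 2`, with `c = 1 + (3/2 + |log w|)/log 2`: the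
`SuperFactorialContact`-shape statement FAILS for it (while `SuperExpContact`-shape holds, `gammaWorld_contact`). -/
theorem gammaWorld_factorialFloor {w : ℝ} (hw : 0 < w) {E : ℝ → ℝ}
    (hE : ∀ x, E x = w * Real.exp (-(3 / 2) * (x - 1) - (x - 1) * Real.log x)) :
    ∃ c : ℝ, 0 < c ∧ ∀ k : ℕ, 2 ≤ k → Real.exp (-(c * k * Real.log k)) ≤ E k := by
  have hl2 : 0 < Real.log 2 := Real.log_pos one_lt_two
  refine ⟨1 + (3 / 2 + |Real.log w|) / Real.log 2, by positivity, fun k hk => ?_⟩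
  have hk2 : (2 : ℝ) ≤ k := by exact_mod_cast hk
  have hkpos : (0 : ℝ) < k := by linarith
  have hℓ : Real.log 2 ≤ Real.log k := Real.log_le_log two_pos hk2
  have hℓ0 : 0 ≤ Real.log k := hl2.le.trans hℓ
  have hwexp : w = Real.exp (Real.log w) := (Real.exp_log hw).symm
  rw [hE, hwexp, ← Real.exp_add, Real.exp_le_exp, ← hwexp]
  have e : (1 + (3 / 2 + |Real.log w|) / Real.log 2) * k * Real.log k =
      k * Real.log k + (3 / 2 + |Real.log w|) * k * (Real.log k / Real.log 2) := by
    field_simp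
  have h1 : (3 / 2 + |Real.log w|) * k ≤ (3 / 2 + |Real.log w|) * k * (Real.log k / Real.log 2) :=
    le_mul_of_one_le_right (by positivity) (by rw [le_div_iff₀ hl2, one_mul]; exact hℓ)
  have h2 : |Real.log w| ≤ |Real.log w| * k := le_mul_of_one_le_right (abs_nonneg _) (by linarith)
  have h3 : -Real.log w ≤ |Real.log w| := neg_le_abs _
  rw [e]
  nlinarith [mul_nonneg hkpos.le hℓ0, h1, h2, h3]

/-- **The gamma world is TWO-SIDED STRICT (PROVED, packaged).**  For every `w > 0` there is a profile with a
supporting line, the EDD-shape law `E(m)² ≤ 1·exp(2 log 2·(m−1))·w·E(2m−1)`, `SuperExpContact`-shape contact,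
a FACTORIAL FLOOR (so NOT `SuperFactorialContact`-shape), and NO summable dyadic envelope (not SLD-shape).
Hence `EDD ⊋ SLD` and `SEC ⊋ SFC` as profile classes, the rate `k·log k` of `factorialFloor_expDefect` is
attained, and the mixed pair (SEC, EDD) does not close: the trade SEC ↦ SFC is forced. -/
theorem gammaWorld_twoSided {w : ℝ} (hw : 0 < w) :
    ∃ (E : ℝ → ℝ) (s : ℝ), 0 ≤ s ∧ (∀ m : ℝ, 1 ≤ m → w - s * (m - 1) ≤ E m) ∧
      (∀ m : ℝ, 1 < m → E m ^ 2 ≤ 1 * Real.exp (2 * Real.log 2 * (m - 1)) * w * E (2 * m - 1)) ∧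
      (∀ ρ : ℝ, 0 < ρ → ∃ k : ℕ, 2 ≤ k ∧ E k < ρ ^ k) ∧
      (∃ c : ℝ, 0 < c ∧ ∀ k : ℕ, 2 ≤ k → Real.exp (-(c * k * Real.log k)) ≤ E k) ∧
      ∀ C : ℕ → ℝ, Summable (fun i : ℕ => Real.log (C i) / 2 ^ i) →
        ∃ (i : ℕ) (m : ℝ), 1 < m ∧ m ≤ 2 ^ i + 1 ∧ C i * w * E (2 * m - 1) < E m ^ 2 := by
  refine ⟨fun x => w * Real.exp (-(3 / 2) * (x - 1) - (x - 1) * Real.log x), 5 / 2 * w, by positivity,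
    ?_, fun m hm => ?_, ?_, ?_, fun C hS => ?_⟩
  · have h := gammaWorld_line hw (E := fun x => w * Real.exp (-(3 / 2) * (x - 1) - (x - 1) * Real.log x))
      (fun _ => rfl)
    intro m hm
    have := h m hm
    linarith
  · rw [one_mul]
    exact gammaWorld_linearDefect hw (E := fun x => w * Real.exp (-(3 / 2) * (x - 1) - (x - 1) * Real.log x))
      (fun _ => rfl) m hm
  · exact gammaWorld_contact hw (E := fun x => w * Real.exp (-(3 / 2) * (x - 1) - (x - 1) * Real.log x))
      (fun _ => rfl)
  · exact gammaWorld_factorialFloor hw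
      (E := fun x => w * Real.exp (-(3 / 2) * (x - 1) - (x - 1) * Real.log x)) (fun _ => rfl)
  · exact gammaWorld_not_sld hw (E := fun x => w * Real.exp (-(3 / 2) * (x - 1) - (x - 1) * Real.log x))
      (fun _ => rfl) C hS

/-! ## §3 The Gaussian world: `EDD` is load-bearing in the traded cut, and the dial goes on -/

/-- **Supporting line of the Gaussian world (PROVED).**  `E(x) = w·exp(−(x−1)²)` (`w > 0`) satisfies
`E(m) ≥ w − w(m−1)` on `[1,∞)` (`e^{−u²} ≥ 1 − u² ≥ 1 − u` for `u ≤ 1`; the line is `≤ 0` beyond). -/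
theorem gaussWorld₂_line {w : ℝ} (hw : 0 < w) {E : ℝ → ℝ} (hE : ∀ x, E x = w * Real.exp (-(x - 1) ^ 2)) :
    ∀ m : ℝ, 1 ≤ m → w - w * (m - 1) ≤ E m := by
  intro m hm
  rw [hE]
  have hexp := Real.exp_pos (-(m - 1) ^ 2)
  rcases le_or_gt 1 (m - 1) with hu | hu
  · nlinarith [mul_pos hw hexp]
  · have hm0 : 0 ≤ m - 1 := by linarith
    have hg : -(m - 1) ^ 2 + 1 ≤ Real.exp (-(m - 1) ^ 2) := Real.add_one_le_exp _
    nlinarith [mul_le_mul_of_nonneg_left hg hw.le, mul_le_mul_of_nonneg_left hu.le hm0]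

/-- **The NEXT law holds with equality (PROVED):** `E(m)² = exp(2(m−1)²)·w·E(2m−1)` — a GAUSSIAN doubling
defect (dyadic envelope `log C_i ≍ 4^i`). -/
theorem gaussWorld₂_gdd (w : ℝ) {E : ℝ → ℝ} (hE : ∀ x, E x = w * Real.exp (-(x - 1) ^ 2)) (m : ℝ) :
    E m ^ 2 = Real.exp (2 * (m - 1) ^ 2) * w * E (2 * m - 1) := by
  rw [hE, hE, mul_pow, sq (Real.exp _), ← Real.exp_add]
  have e : Real.exp (-(m - 1) ^ 2 + -(m - 1) ^ 2) = Real.exp (2 * (m - 1) ^ 2) * Real.exp (-(2 * m - 1 - 1) ^ 2) := by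
    rw [← Real.exp_add]; congr 1; ring
  rw [e]; ring

/-- **… but NO exponential doubling defect (PROVED):** for all `C, A` there is `m > 1` with
`C·exp(A(m−1))·w·E(2m−1) < E(m)²` (take `u = m − 1 ≥ max(1, A, log C + 1)`: `2u² > Au + log C`). -/
theorem gaussWorld₂_not_edd {w : ℝ} (hw : 0 < w) {E : ℝ → ℝ} (hE : ∀ x, E x = w * Real.exp (-(x - 1) ^ 2))
    (C A : ℝ) : ∃ m : ℝ, 1 < m ∧ C * Real.exp (A * (m - 1)) * w * E (2 * m - 1) < E m ^ 2 := by
  set u : ℝ := max 1 (max A (Real.log C + 1)) with hu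
  have hu1 : 1 ≤ u := le_max_left _ _
  have huA : A ≤ u := (le_max_left _ _).trans (le_max_right _ _)
  have huC : Real.log C + 1 ≤ u := (le_max_right _ _).trans (le_max_right _ _)
  refine ⟨1 + u, by linarith, ?_⟩
  have e1 : (1 : ℝ) + u - 1 = u := by ring
  have e2 : (2 : ℝ) * (1 + u) - 1 - 1 = 2 * u := by ring
  rw [hE, hE, e2, e1]
  have key : C * Real.exp (A * u) < Real.exp (2 * (-u ^ 2) - (-(2 * u) ^ 2)) := by
    have e3 : (2 : ℝ) * (-u ^ 2) - (-(2 * u) ^ 2) = 2 * u ^ 2 := by ring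
    rw [e3]
    rcases le_or_gt C 0 with hC0 | hC0
    · exact (mul_nonpos_of_nonpos_of_nonneg hC0 (Real.exp_pos _).le).trans_lt (Real.exp_pos _)
    · rw [← Real.exp_log hC0, ← Real.exp_add, Real.exp_lt_exp]
      have hu0 : (0 : ℝ) ≤ u := by linarith
      nlinarith [mul_le_mul_of_nonneg_right huA hu0, mul_le_mul_of_nonneg_right hu1 hu0]
  exact defect_witness_of_exp hw key

/-- **… and SUPERFACTORIAL contact (PROVED):** for `w ≤ 1` and every `c > 0` there is `k ≥ 2` with
`E(k) < exp(−c·k·log k)` (take `k = N²`, `N ≥ 4c`, `N ≥ 2`: `c·k·log k ≤ 2c·N²·(N−1) < N⁴/2 ≤ (k−1)²`). -/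
theorem gaussWorld₂_sfc {w : ℝ} (hw1 : w ≤ 1) {E : ℝ → ℝ}
    (hE : ∀ x, E x = w * Real.exp (-(x - 1) ^ 2)) :
    ∀ c : ℝ, 0 < c → ∃ k : ℕ, 2 ≤ k ∧ E k < Real.exp (-(c * k * Real.log k)) := by
  intro c hc
  obtain ⟨N, hN⟩ := exists_nat_ge (4 * c + 2)
  have hN2 : (2 : ℝ) ≤ N := by linarith
  have hN2' : 2 ≤ N := by exact_mod_cast hN2
  have hNpos : (0 : ℝ) < N := by linarith
  refine ⟨N * N, by nlinarith, ?_⟩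
  rw [hE]
  have hlogN : Real.log N ≤ (N : ℝ) - 1 := Real.log_le_sub_one_of_pos hNpos
  have hlogk : Real.log ((N * N : ℕ) : ℝ) = 2 * Real.log N := by
    push_cast
    rw [Real.log_mul hNpos.ne' hNpos.ne']; ring
  rw [hlogk]
  push_cast
  calc w * Real.exp (-((N : ℝ) * N - 1) ^ 2) ≤ Real.exp (-((N : ℝ) * N - 1) ^ 2) :=
        mul_le_of_le_one_left (Real.exp_pos _).le hw1
    _ < Real.exp (-(c * ((N : ℝ) * N) * (2 * Real.log N))) := by
        rw [Real.exp_lt_exp]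
        have h1 : c * ((N : ℝ) * N) * (2 * Real.log N) ≤ 2 * c * (N * N) * (N - 1) := by
          have := mul_le_mul_of_nonneg_left hlogN (by positivity : (0 : ℝ) ≤ 2 * c * (N * N))
          linarith
        have hN4 : 4 * c ≤ (N : ℝ) := by linarith
        nlinarith [mul_nonneg (mul_nonneg hNpos.le hNpos.le) (sub_nonneg.2 hN4),
          mul_pos (mul_pos hNpos hNpos) hc, pow_nonneg hNpos.le 2]

/-- **… and a GAUSSIAN FLOOR (PROVED):** `E(k) ≥ exp(−(1 + |log w|)·k²)` at every integer `k ≥ 1` — contact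
below every GAUSSIAN rate fails for it: that is the contact leaf the next notch of the dial needs. -/
theorem gaussWorld₂_floor {w : ℝ} (hw : 0 < w) {E : ℝ → ℝ} (hE : ∀ x, E x = w * Real.exp (-(x - 1) ^ 2)) :
    ∀ k : ℕ, 1 ≤ k → Real.exp (-((1 + |Real.log w|) * (k : ℝ) ^ 2)) ≤ E k := by
  intro k hk
  have hk1 : (1 : ℝ) ≤ k := by exact_mod_cast hk
  have hwexp : w = Real.exp (Real.log w) := (Real.exp_log hw).symm
  rw [hE, hwexp, ← Real.exp_add, Real.exp_le_exp, ← hwexp]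
  have h1 : |Real.log w| ≤ |Real.log w| * (k : ℝ) ^ 2 :=
    le_mul_of_one_le_right (abs_nonneg _) (by nlinarith)
  have h2 : -Real.log w ≤ |Real.log w| := neg_le_abs _
  nlinarith

/-- **`EDD` is load-bearing in `closes_eddSfc`, and the next notch is visible (PROVED, packaged).**  For every
`0 < w ≤ 1` there is a profile with a supporting line, `SuperFactorialContact`-shape contact, the Gaussian
doubling law `E(m)² ≤ exp(2(m−1)²)·w·E(2m−1)`, NO exponential doubling defect, and a Gaussian floor: the pair
(SFC, Gaussian defect) does not close — the exponential envelope of `ExpDoublingDefect` cannot be relaxed with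
the partner SFC — and the profile is no counter-model once the contact leaf is raised to all Gaussian rates. -/
theorem edd_loadBearing {w : ℝ} (hw : 0 < w) (hw1 : w ≤ 1) :
    ∃ (E : ℝ → ℝ) (s : ℝ), 0 ≤ s ∧ (∀ m : ℝ, 1 ≤ m → w - s * (m - 1) ≤ E m) ∧
      (∀ c : ℝ, 0 < c → ∃ k : ℕ, 2 ≤ k ∧ E k < Real.exp (-(c * k * Real.log k))) ∧
      (∀ m : ℝ, 1 < m → E m ^ 2 ≤ Real.exp (2 * (m - 1) ^ 2) * w * E (2 * m - 1)) ∧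
      (∀ C A : ℝ, ∃ m : ℝ, 1 < m ∧ C * Real.exp (A * (m - 1)) * w * E (2 * m - 1) < E m ^ 2) ∧
      ∀ k : ℕ, 1 ≤ k → Real.exp (-((1 + |Real.log w|) * (k : ℝ) ^ 2)) ≤ E k :=
  ⟨fun x => w * Real.exp (-(x - 1) ^ 2), w, hw.le,
    gaussWorld₂_line hw (E := fun x => w * Real.exp (-(x - 1) ^ 2)) (fun _ => rfl),
    gaussWorld₂_sfc hw1 (E := fun x => w * Real.exp (-(x - 1) ^ 2)) (fun _ => rfl),
    fun m _ => (gaussWorld₂_gdd w (E := fun x => w * Real.exp (-(x - 1) ^ 2)) (fun _ => rfl) m).le,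
    gaussWorld₂_not_edd hw (E := fun x => w * Real.exp (-(x - 1) ^ 2)) (fun _ => rfl),
    gaussWorld₂_floor hw (E := fun x => w * Real.exp (-(x - 1) ^ 2)) (fun _ => rfl)⟩

/-! ## §4 The exponential world: no fixed-rate contact partners any law -/

/-- **Fixed-rate contact is consistent with EVERY law (PROVED).**  For every anchor value `w > 0` and every rate
`θ > 0`, the world `E(x) = w·exp(−λ(x−1))`, `λ = |log w| + 2|log θ| + 1`, satisfies the real three-term law
`E(k)² = E(k−h)·E(k+h)` and the anchored law `E(m)² = w·E(2m−1)` with EQUALITY, the supporting line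
`E(m) ≥ w − wλ(m−1)`, is ZERO-FREE, and has contact at rate `θ` already at `k = 2`: `E(2) < θ²`.  So the
special leaf of any cut of this dial must quantify over all rates (`SuperExpContact` or stronger): a piece
`∃ k ≥ 2, e(k) < θ^k` at one fixed `θ < 1` decides nothing against the laws. -/
theorem expWorld_fixedRate {w θ : ℝ} (hw : 0 < w) (hθ : 0 < θ) :
    ∃ (E : ℝ → ℝ) (lam : ℝ), 0 ≤ lam ∧ (∀ k h : ℝ, E k ^ 2 = E (k - h) * E (k + h)) ∧
      (∀ m : ℝ, E m ^ 2 = w * E (2 * m - 1)) ∧ (∀ m : ℝ, 1 ≤ m → w - w * lam * (m - 1) ≤ E m) ∧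
      (∀ x : ℝ, 0 < E x) ∧ ∃ k : ℕ, 2 ≤ k ∧ E k < θ ^ k := by
  set lam : ℝ := |Real.log w| + 2 * |Real.log θ| + 1 with hlam
  have hlam0 : 0 ≤ lam := by positivity
  refine ⟨fun x => w * Real.exp (-(lam * (x - 1))), lam, hlam0, fun k h => ?_, fun m => expWorld_law_eq w lam m,
    fun m hm => ?_, fun x => mul_pos hw (Real.exp_pos _), 2, le_rfl, ?_⟩
  · show (w * Real.exp (-(lam * (k - 1)))) ^ 2 =
      w * Real.exp (-(lam * (k - h - 1))) * (w * Real.exp (-(lam * (k + h - 1))))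
    have e : -(lam * (k - 1)) + -(lam * (k - 1)) = -(lam * (k - h - 1)) + -(lam * (k + h - 1)) := by ring
    rw [mul_pow, sq (Real.exp _), ← Real.exp_add, e, Real.exp_add]
    ring
  · show w - w * lam * (m - 1) ≤ w * Real.exp (-(lam * (m - 1)))
    have hg : -(lam * (m - 1)) + 1 ≤ Real.exp (-(lam * (m - 1))) := Real.add_one_le_exp _
    nlinarith
  · show w * Real.exp (-(lam * ((2 : ℕ) - 1 : ℝ))) < θ ^ 2
    have hwexp : w = Real.exp (Real.log w) := (Real.exp_log hw).symm
    have hθ2 : Real.exp (2 * Real.log θ) = θ ^ 2 := by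
      rw [show (2 : ℝ) * Real.log θ = ((2 : ℕ) : ℝ) * Real.log θ by norm_num, Real.exp_nat_mul,
        Real.exp_log hθ]
    have h1 := le_abs_self (Real.log w)
    have h2 := neg_abs_le (Real.log θ)
    have e1 : -(lam * (((2 : ℕ) : ℝ) - 1)) = -lam := by push_cast; ring
    rw [e1, hwexp, ← Real.exp_add, ← hθ2, Real.exp_lt_exp]
    rw [hlam]
    linarith

end Summit.MatrixMultiplication.MatrixMultiplication.Theorems.FarEdgeDescentContactScale

end
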